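import Summits.ResolutionOfSingularities.ResolutionOfSingularities.Theorems.HilbertSamuelEliminationCampaignW42TertiaryStates
import Mathlib.Topology.NoetherianSpace
import Mathlib.Topology.Separation.Basic
import HarnessLib

/-!
# [OURS · L1 W4.2] Compactness: an infinite canonical sequence `S(X, ν)` at an isolated origin carries an infinite chain
# of closed near points — so `TertiaryTermination p` is EXACTLY the finiteness of `S(X, ν)` over `x`
# (informal crux `TertiaryTermination`, stmt-ResolutionOfSingularities-17846; `--supports stmt-…-17846`)

OURS (slot W4.2, prover seat res-L1-s42-pv-2); NOT statements of H. Hironaka's manuscript; AI review is weaker than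
expert review. The Reduction file proved `chain ⇒ CanonicalSequenceInfinite`; this file proves the CONVERSE at an
isolated origin (the König / compactness step CJS use tacitly on p. 105: «all its points lie above … finitely many
closed points»): if `S(X, ν)` has initial segments of every length (tree `CanonicalSequenceInfinite`, functional
oracle) and its centres are PERMISSIBLE (CJS Lemma 5.34 (3) / Thm. 3.3 in the source's setting — here the hypothesis
`∀ t, t.IsCanonicalRun R N ν → t.AllPermissible`), then there IS an infinite chain of canonical near steps from the
initial marked stage: closed points `x_{n+1} ↦ x_n` in the `ν`-strata. Bookkeeping (`StateGood`, runs) is the sibling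
`…CampaignW42TertiaryStates.lean`; here: Noetherian induction on closed sets (`WellFoundedLT (Closeds _)`), proper
images (`Scheme.Hom.isClosedMap`), closed points in non-empty closed subsets of quasi-compact schemes
(`IsClosed.exists_closed_singleton`).

PROVED here:
* `MarkedGood` — a good marked stage: in scope, good state, `S` infinite from it, marked point PERSISTENT (every
  canonical run from the state has a stratum point over it); `markedGood_init` — the initial marked stage is good.
* `exists_canonicalNearStep_of_good` — THE SUCCESSOR STEP: the sets `A_m` of points of the blow-up over the marked
  point carrying a stratum point at depth `m` are closed, non-empty and decreasing; they stabilise, and a closed point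
  of their intersection is the next marked point.
* `exists_nearChain_of_canonicalSequenceInfinite` — THE CHAIN (dependent choice): converse of
  `canonicalSequenceInfinite_of_chain`; `not_canonicalSequenceInfinite_of_noNearChain`,
  `not_canonicalSequenceInfinite_of_tertiaryTermination` — `TertiaryTermination p` forbids an infinite `S(X, ν)` at
  every isolated origin of characteristic `p` with permissible canonical centres; with `noNearChain_init_of_terminates`
  (Reduction file) the OURS statement is bracketed by the tree's `CanonicalSequenceTerminates` / `¬ CanonicalSequenceInfinite`.

## References

* V. Cossart, U. Jannsen, S. Saito, LNM 2270 (2020), Rem. 6.29 (1), p. 105, p. 107. [CossartJannsenSaito2020]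
-/

noncomputable section

set_option linter.dupNamespace false -- mandated namespace of this single-conjunct summit

open CategoryTheory AlgebraicGeometry TopologicalSpace Topology

namespace Summit.ResolutionOfSingularities.ResolutionOfSingularities.Theorems

namespace CampaignW42

open Literature.AlgebraicGeometry.Resolution Literature.RingTheory.HilbertSamuel

universe u

variable {p : ℕ} {R : ∀ S : Scheme.{u}, CentreSeq S → Prop} {N : ℕ} {ν : ℕ → ℕ}
variable {k : Type u} [Field k]

/-! ## The successor step -/

/-- A good MARKED stage: in scope, its state good, `S` infinite from it, and its marked point PERSISTENT — every
canonical run from the state has a stratum point over it. OURS bookkeeping; NOT a statement of the manuscript.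
[folklore] -/
structure MarkedGood (p : ℕ) (k : Type u) [Field k] (R : ∀ S : Scheme.{u}, CentreSeq S → Prop) (N : ℕ)
    (ν : ℕ → ℕ) (s : MarkedStage.{u}) : Prop where
  /-- in scope -/
  inScope : InScope p R N ν s
  /-- the state is good -/
  good : StateGood k R N ν s.W s.L s.P
  /-- `S(X, ν)` has runs of every length from the state -/
  infiniteFrom : ∀ m, ∃ t : CentreSeq s.W, IsCanonicalRunFrom R N ν s.L s.P t ∧ t.length = m
  /-- the marked point is persistent -/
  persistent : ∀ t : CentreSeq s.W, IsCanonicalRunFrom R N ν s.L s.P t →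
    ∃ z : t.top, z ∈ Scheme.hsStratum t.top N ν ∧ t.comp.base z = s.pt

/-- **THE SUCCESSOR STEP** (compactness): from a good marked stage there is a canonical near step to a good marked
stage. The sets `A_m` of points of the exceptional blow-up over the marked point that carry a stratum point at depth
`m` are closed (proper images of closed strata), non-empty (persistence) and decreasing (last-step bookkeeping); by
Noetherian induction they stabilise, and a closed point of their intersection is the next marked point.
[cite: CossartJannsenSaito2020, p. 105] -/
theorem exists_canonicalNearStep_of_good (hRf : OracleFunctional R) {s : MarkedStage.{u}}
    (hs : MarkedGood p k R N ν s) : ∃ s', CanonicalNearStep R N ν s s' ∧ MarkedGood p k R N ν s' := by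
  haveI : IsLocallyNoetherian s.W := s.ln
  -- the canonical step from `s`
  obtain ⟨t₁, ht₁, hlen₁⟩ := hs.infiniteFrom 1
  obtain ⟨C, rest₁, rfl⟩ : ∃ (C : s.W.IdealSheafData) (rest : CentreSeq (blowup C)),
      t₁ = CentreSeq.cons C rest := by
    cases t₁ with
    | nil _ => simp at hlen₁
    | cons C rest => exact ⟨C, rest, rfl⟩
  obtain ⟨P', hst, -⟩ := ht₁
  have hgood' : StateGood k R N ν (blowup C) (s.L.next (Scheme.hsStratum s.W N ν) C) P' := hs.good.next hst
  haveI : IsLocallyNoetherian (blowup C) := hgood'.isLocallyNoetherian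
  haveI : IsNoetherian (blowup C) := hgood'.isNoetherian
  -- runs from the next state
  have hinf' : ∀ m, ∃ r : CentreSeq (blowup C),
      IsCanonicalRunFrom R N ν (s.L.next (Scheme.hsStratum s.W N ν) C) P' r ∧ r.length = m := by
    intro m
    obtain ⟨t, ht, hlen⟩ := hs.infiniteFrom (m + 1)
    obtain ⟨rest, rfl, hrest, hrlen⟩ := exists_eq_cons_of_run hRf hst ht hlen
    exact ⟨rest, hrest, hrlen⟩
  choose r hr hrlen using hinf'
  -- the sets `A m`
  let A : ℕ → Set ↥(blowup C) := fun m =>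
    {y' | (blowup.π C).base y' = s.pt ∧
      ∃ z : (r m).top, z ∈ Scheme.hsStratum (r m).top N ν ∧ (r m).comp.base z = y'}
  -- every run of length `m` from the next state is `r m`
  have hruniq : ∀ {m} (t : CentreSeq (blowup C)),
      IsCanonicalRunFrom R N ν (s.L.next (Scheme.hsStratum s.W N ν) C) P' t → t.length = m → t = r m :=
    fun t ht hlen => IsCanonicalRunFrom.eq_of_length_eq hRf ht (hr _) (hlen.trans (hrlen _).symm)
  -- closed
  have hAclosed : ∀ m, IsClosed (A m) := by
    intro m
    obtain ⟨L'', P''', hgtop⟩ := exists_stateGood_top_of_run m hgood' (r m) (hr m) (hrlen m)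
    have h1 : IsClosed ((fun y' : ↥(blowup C) => (blowup.π C).base y') ⁻¹' {s.pt}) :=
      hs.inScope.isClosed_pt.preimage (blowup.π C).continuous
    haveI : IsProper (r m).comp := CentreSeq.isProper_comp (r m)
    have h2 : IsClosed ((fun z : ↥((r m).top) => (r m).comp.base z) '' Scheme.hsStratum (r m).top N ν) :=
      (r m).comp.isClosedMap _ hgtop.isClosed_hsStratum
    have hA : A m = ((fun y' : ↥(blowup C) => (blowup.π C).base y') ⁻¹' {s.pt}) ∩
        ((fun z : ↥((r m).top) => (r m).comp.base z) '' Scheme.hsStratum (r m).top N ν) := by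
      ext y'
      simp only [A, Set.mem_setOf_eq, Set.mem_inter_iff, Set.mem_preimage, Set.mem_singleton_iff, Set.mem_image]
    rw [hA]
    exact h1.inter h2
  -- non-empty
  have hAne : ∀ m, (A m).Nonempty := by
    intro m
    obtain ⟨z, hz, hzeq⟩ := hs.persistent (CentreSeq.cons C (r m)) ⟨P', hst, hr m⟩
    exact ⟨(r m).comp.base z, hzeq, z, hz, rfl⟩
  -- decreasing
  have hAanti : ∀ m, A (m + 1) ⊆ A m := by
    intro m y' hy'
    obtain ⟨hπ, z', hz', hzeq'⟩ := hy'
    obtain ⟨t, ht, htlen, z, hz, hzeq⟩ :=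
      exists_run_pred_of_run_succ m hgood' (r (m + 1)) (hr _) (hrlen _) z' hz'
    obtain rfl : t = r m := hruniq t ht htlen
    exact ⟨hπ, z, hz, hzeq.trans hzeq'⟩
  have hAanti' : Antitone A := antitone_nat_of_succ_le hAanti
  -- stabilisation (Noetherian induction on closed sets)
  obtain ⟨M, hM⟩ : ∃ M, ∀ m, M ≤ m → A m = A M := by
    let F : ℕ → Closeds ↥(blowup C) := fun m => ⟨A m, hAclosed m⟩
    obtain ⟨B, ⟨M, rfl⟩, hmin⟩ :=
      (wellFounded_lt (α := Closeds ↥(blowup C))).has_min (Set.range F) ⟨F 0, 0, rfl⟩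
    refine ⟨M, fun m hm => ?_⟩
    have hle : F m ≤ F M := hAanti' hm
    have hnlt : ¬ F m < F M := hmin (F m) ⟨m, rfl⟩
    have heq : F m = F M := hle.eq_or_lt.resolve_right hnlt
    exact congrArg (fun B : Closeds ↥(blowup C) => (B : Set ↥(blowup C))) heq
  -- a closed point in the intersection
  haveI : CompactSpace ↥(blowup C) := inferInstance
  obtain ⟨y', hy'M, hy'cl⟩ := (hAclosed M).exists_closed_singleton (hAne M)
  have hy' : ∀ m, y' ∈ A m := by
    intro m
    rcases le_total M m with hm | hm
    · rw [hM m hm]; exact hy'M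
    · exact hAanti' hm hy'M
  -- the next marked stage
  obtain ⟨hπy', z₀, hz₀, hz₀eq⟩ := hy' 0
  have hr0 : r 0 = CentreSeq.nil _ := by
    have := hrlen 0
    cases h : r 0 with
    | nil _ => rfl
    | cons _ _ => rw [h] at this; simp at this
  have hy'str : y' ∈ Scheme.hsStratum (blowup C) N ν := by
    have key : ∀ (t : CentreSeq (blowup C)) (ht : t = CentreSeq.nil _) (z : t.top),
        z ∈ Scheme.hsStratum t.top N ν → t.comp.base z = y' → y' ∈ Scheme.hsStratum (blowup C) N ν := by
      intro t ht z hz hzeq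
      subst ht
      simpa using (show (CentreSeq.nil (blowup C)).comp.base z = y' from hzeq) ▸ hz
    exact key (r 0) hr0 z₀ hz₀ hz₀eq
  refine ⟨⟨blowup C, inferInstance, s.L.next (Scheme.hsStratum s.W N ν) C, P', y'⟩,
    ⟨C, P', inferInstance, y', hst, hπy', hy'cl, hy'str, rfl⟩, ?_⟩
  exact
    { inScope := hs.inScope.step ⟨C, P', inferInstance, y', hst, hπy', hy'cl, hy'str, rfl⟩
      good := hgood'
      infiniteFrom := fun m => ⟨r m, hr m, hrlen m⟩
      persistent := fun t ht => by
        have ht' : t = r t.length := hruniq t ht rfl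
        obtain ⟨-, z, hz, hzeq⟩ := hy' t.length
        rw [ht']
        exact ⟨z, hz, hzeq⟩ }

/-! ## The chain -/

/-- **THE INITIAL MARKED STAGE IS GOOD** when `S(X, ν)` is infinite and its centres are permissible: `ν` maximal is
never exceeded, and every stratum point of every stage lies over `x` (`X(ν) = {x}`, `H^N` non-increasing).
[folklore] -/
theorem markedGood_init (hRf : OracleFunctional R) {X : Scheme.{u}} [IsLocallyNoetherian X] {x : X}
    (hX : IsIsolatedOrigin p N ν X x) (f : X ⟶ Spec (.of k)) [LocallyOfFiniteType f] [QuasiCompact f]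
    (hperm : ∀ t : CentreSeq X, t.IsCanonicalRun R N ν → t.AllPermissible)
    (hinf : CanonicalSequenceInfinite R N ν X) : MarkedGood p k R N ν (MarkedStage.init X x) := by
  have hsup : ∀ w : X, ν ≤ Scheme.hsFun X N w → Scheme.hsFun X N w = ν :=
    fun w hw => le_antisymm (hX.maximal.2 ⟨w, rfl⟩ hw) hw
  have hgood : StateGood k R N ν X (Labelling.init X) none := ⟨⟨f, ‹_›, ‹_›⟩, hX.dim_le, hsup, hperm⟩
  refine ⟨InScope.init hX, hgood, hinf, fun t ht => ?_⟩
  obtain ⟨z, hz⟩ := hsStratum_top_nonempty_of_runs hRf t.length t ht rfl (hinf (t.length + 1))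
  refine ⟨z, hz, ?_⟩
  have hle := hsFun_comp_le_of_run hgood t ht z
  have hmem : t.comp.base z ∈ Scheme.hsStratum X N ν :=
    hsup _ ((Scheme.mem_hsStratum_iff.mp hz).symm.le.trans hle)
  rw [hX.stratum_eq] at hmem
  exact hmem

/-- **AN INFINITE `S(X, ν)` AT AN ISOLATED ORIGIN CARRIES AN INFINITE CHAIN OF CLOSED NEAR POINTS** (functional oracle,
permissible canonical centres): the converse of `canonicalSequenceInfinite_of_chain`.
[cite: CossartJannsenSaito2020, p. 105, p. 107] -/
theorem exists_nearChain_of_canonicalSequenceInfinite (hRf : OracleFunctional R) {X : Scheme.{u}}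
    [IsLocallyNoetherian X] {x : X} (hX : IsIsolatedOrigin p N ν X x)
    (hperm : ∀ t : CentreSeq X, t.IsCanonicalRun R N ν → t.AllPermissible)
    (hinf : CanonicalSequenceInfinite R N ν X) :
    ∃ c : ℕ → MarkedStage.{u}, c 0 = MarkedStage.init X x ∧ ∀ n, CanonicalNearStep R N ν (c n) (c (n + 1)) := by
  obtain ⟨k, _, _, f, -, hft, hqc⟩ := hX.exists_structure
  haveI := hft
  haveI := hqc
  have h0 : MarkedGood p k R N ν (MarkedStage.init X x) := markedGood_init hRf hX f hperm hinf
  have hsucc : ∀ s : {s : MarkedStage.{u} // MarkedGood p k R N ν s},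
      ∃ s' : {s : MarkedStage.{u} // MarkedGood p k R N ν s}, CanonicalNearStep R N ν s.1 s'.1 := by
    rintro ⟨s, hs⟩
    obtain ⟨s', hss', hs'⟩ := exists_canonicalNearStep_of_good hRf hs
    exact ⟨⟨s', hs'⟩, hss'⟩
  choose g hg using hsucc
  let c : ℕ → {s : MarkedStage.{u} // MarkedGood p k R N ν s} :=
    fun n => Nat.rec ⟨MarkedStage.init X x, h0⟩ (fun _ s => g s) n
  exact ⟨fun n => (c n).1, rfl, fun n => hg (c n)⟩

/-- **No infinite near chain ⇒ `S(X, ν)` is not infinite** at an isolated origin (functional oracle, permissible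
canonical centres). [folklore] -/
theorem not_canonicalSequenceInfinite_of_noNearChain (hRf : OracleFunctional R) {X : Scheme.{u}}
    [IsLocallyNoetherian X] {x : X} (hX : IsIsolatedOrigin p N ν X x)
    (hperm : ∀ t : CentreSeq X, t.IsCanonicalRun R N ν → t.AllPermissible)
    (h : NoNearChainFrom R N ν (MarkedStage.init X x) fun _ => True) : ¬ CanonicalSequenceInfinite R N ν X := by
  intro hinf
  obtain ⟨c, hc0, hstep⟩ := exists_nearChain_of_canonicalSequenceInfinite hRf hX hperm hinf
  exact h ⟨c, hc0 ▸ Relation.ReflTransGen.refl, hstep, fun _ => trivial⟩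

/-- **`TertiaryTermination p` FORBIDS AN INFINITE `S(X, ν)`** at every isolated origin of characteristic `p`, for every
functional admissible oracle whose canonical centres are permissible (CJS Lemma 5.34 (3) in the source's setting): the
OURS statement is exactly the finiteness CJS isolate on p. 107. [cite: CossartJannsenSaito2020, p. 107] -/
theorem not_canonicalSequenceInfinite_of_tertiaryTermination (h : TertiaryTermination.{u} p)
    (hRf : OracleFunctional R) (hRa : OracleAdmissible R) {X : Scheme.{u}} [IsLocallyNoetherian X] {x : X}
    (hX : IsIsolatedOrigin p N ν X x) (hperm : ∀ t : CentreSeq X, t.IsCanonicalRun R N ν → t.AllPermissible) :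
    ¬ CanonicalSequenceInfinite R N ν X :=
  not_canonicalSequenceInfinite_of_noNearChain hRf hX hperm (h R hRf hRa N ν X x hX)

end CampaignW42

end Summit.ResolutionOfSingularities.ResolutionOfSingularities.Theorems

end
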